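import Literature.MathematicalPhysics.KineticTheory.HardSphereBBGKYLiouville
import Literature.Analysis.FluidPDE.HardSphereDynamicsProofs
import Literature.Analysis.FluidPDE.HardSphereFreeStretch
import Mathlib.MeasureTheory.Function.Floor
import Mathlib.MeasureTheory.Constructions.BorelSpace.Metrizable
import HarnessLib

/-!
# Hard-sphere flows: energy, measure and joint measurability toolkit

First file of the proof of `Literature.MathematicalPhysics.KineticTheory.bbgky_hierarchy_of_liouville`
(**hilbert6.S07**, from the Liouville equation to the mild BBGKY hierarchy; equivalently K3's
`Literature.Analysis.FluidPDE.liouville_imp_bbgky`, see `HardSphereBBGKYLiouville`). It collects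
elementary consequences of the axioms of the hypothesis structure
`Literature.Analysis.FluidPDE.HardSphereFlow` (Alexander's theorem as data: a conull invariant good
set on which the flow is a group of hard-sphere trajectories, each time-`t` map measurable and
Liouville-preserving) that the later files use:

* `HardSphereFlow.configEnergy_flow`: the kinetic energy is invariant along the flow on the good
  set (`IsHardSphereTrajectory.configEnergy_eq_holds`).
* `HardSphereFlow.flow_flow_neg`, `image_eq_preimage_of_subset_good`: on the good set `Φ_t` is a
  bijection with inverse `Φ_{-t}`, so images of good sets are preimages.
* `HardSphereFlow.liouville_preimage_null`, `volume_restrict_good_eq`,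
  `measurePreserving_restrict_good`: null sets pull back to null sets, the Liouville measure
  restricted to the good set is Lebesgue measure restricted to the good set, and each `Φ_t`
  preserves it (a restatement of `measurePreserving` convenient for product / Fubini arguments).
* `HardSphereFlow.tendsto_flow_nhdsGT`: orbits of good points are right-continuous (for a
  geometry with continuous translations, e.g. `T^d`), from
  `IsHardSphereTrajectory.tendsto_nhdsGT`.
* `HardSphereFlow.measurable_piecewise_flow`: **joint measurability** of `(t, z) ↦ Φ_t z` on
  `ℝ × good` (the structure only records measurability of each `Φ_t`): the orbit being
  right-continuous, `Φ_t z` is the pointwise limit of `Φ_{d_n(t)} z` along the dyadic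
  approximations `d_n(t) = (⌊2^n t⌋ + 1)/2^n ↓ t`, each of which is measurable because `d_n` takes
  countably many values (`measurable_from_prod_countable_left`,
  `measurable_of_tendsto_metrizable`). Off the good set we use the junk value `z`
  (`good.piecewise (Φ_t) id`).
* `HardSphereFlow.ae_volume_setOf_flow_mem_eq_zero`: **a.e. orbit spends a null set of times in a
  null set** — if `liouville S = 0` then for Liouville-a.e. `z`, `{t | Φ_t z ∈ S}` is Lebesgue-null
  (Tonelli on `ℝ × Config` for the jointly measurable piecewise flow, and invariance of the
  Liouville measure at each fixed time).

All statements are theorems about the K2 structure; no definition and no named fact is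
introduced.

## References

* R. K. Alexander, *The infinite hard sphere system*, PhD thesis, Berkeley (1975), Ch. 2
  (measurability and invariance of the hard-sphere flow).
* C. Cercignani, R. Illner, M. Pulvirenti, *The Mathematical Theory of Dilute Gases*, Springer
  (1994), §4.2 (Liouville measure, invariance), App. 4.A.
* I. Gallagher, L. Saint-Raymond, B. Texier, *From Newton to Boltzmann*, EMS (2013),
  arXiv:1208.5753, Prop. 4.1.1.
-/

open MeasureTheory Set Filter Topology

namespace Literature.MathematicalPhysics.KineticTheory

open Literature.Analysis.FluidPDE

noncomputable section

variable {d : Type*} [Fintype d]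

/-! ## §1. Energy, inverses and images on the good set -/

section Good

variable {X : Type*} [MeasureSpace X] [TopologicalSpace X] {G : Geometry d X} {ε : ℝ} {N : ℕ}

/-- **Energy is invariant along a hard-sphere flow**: for a good initial datum,
`E(Φ_t z) = E(z)` (free flight keeps the velocities, elastic collisions preserve `½ ∑ |v_i|²`;
`IsHardSphereTrajectory.configEnergy_eq_holds` applied to the orbit and `flow_zero`)
(GST 2013 §1.1; CIP 1994 §4.2). [cite: GST2013, §1.1] -/
theorem _root_.Literature.Analysis.FluidPDE.HardSphereFlow.configEnergy_flow
    (Φ : HardSphereFlow G ε N) {z : Config N d X} (hz : z ∈ Φ.good) (t : ℝ) :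
    configEnergy (Φ.flow t z) = configEnergy z := by
  have h := IsHardSphereTrajectory.configEnergy_eq_holds (Φ.isTrajectory z hz) t 0
  simpa [Φ.flow_zero z hz] using h

/-- On the good set `Φ_t` inverts `Φ_{-t}` (companion of `HardSphereFlow.flow_neg_flow`). [folklore] -/
theorem _root_.Literature.Analysis.FluidPDE.HardSphereFlow.flow_flow_neg
    (Φ : HardSphereFlow G ε N) (t : ℝ) {z : Config N d X} (hz : z ∈ Φ.good) :
    Φ.flow t (Φ.flow (-t) z) = z := by
  simpa using Φ.flow_neg_flow (-t) hz

/-- `Φ_t` is injective on the good set. [folklore] -/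
theorem _root_.Literature.Analysis.FluidPDE.HardSphereFlow.injOn_flow
    (Φ : HardSphereFlow G ε N) (t : ℝ) : InjOn (Φ.flow t) Φ.good := by
  intro z hz w hw h
  rw [← Φ.flow_neg_flow t hz, ← Φ.flow_neg_flow t hw, h]

/-- `Φ_t` maps the good set onto itself. [folklore] -/
theorem _root_.Literature.Analysis.FluidPDE.HardSphereFlow.surjOn_flow
    (Φ : HardSphereFlow G ε N) (t : ℝ) : SurjOn (Φ.flow t) Φ.good Φ.good :=
  fun z hz => ⟨Φ.flow (-t) z, Φ.mapsTo_good (-t) hz, Φ.flow_flow_neg t hz⟩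

/-- The image of a subset of the good set under `Φ_t` is the preimage under `Φ_{-t}` within the
good set: `Φ_t(A) = Φ_{-t}⁻¹(A) ∩ good` for `A ⊆ good`. [folklore] -/
theorem _root_.Literature.Analysis.FluidPDE.HardSphereFlow.image_eq_preimage_of_subset_good
    (Φ : HardSphereFlow G ε N) (t : ℝ) {A : Set (Config N d X)} (hA : A ⊆ Φ.good) :
    Φ.flow t '' A = Φ.flow (-t) ⁻¹' A ∩ Φ.good := by
  ext w
  constructor
  · rintro ⟨z, hz, rfl⟩
    exact ⟨by rw [mem_preimage, Φ.flow_neg_flow t (hA hz)]; exact hz, Φ.mapsTo_good t (hA hz)⟩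
  · rintro ⟨hw, hwg⟩
    exact ⟨Φ.flow (-t) w, hw, Φ.flow_flow_neg t hwg⟩

/-- Preimages of Liouville-null sets under `Φ_t` are Liouville-null (measure preservation; no
measurability of the set is needed). [folklore] -/
theorem _root_.Literature.Analysis.FluidPDE.HardSphereFlow.liouville_preimage_null
    (Φ : HardSphereFlow G ε N) (t : ℝ) {S : Set (Config N d X)} (hS : liouville G N ε S = 0) :
    liouville G N ε (Φ.flow t ⁻¹' S) = 0 :=
  (Φ.measurePreserving t).preimage_null hS

/-- The image of a Liouville-null subset of the good set under `Φ_t` is Liouville-null. [folklore] -/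
theorem _root_.Literature.Analysis.FluidPDE.HardSphereFlow.liouville_image_null
    (Φ : HardSphereFlow G ε N) (t : ℝ) {S : Set (Config N d X)} (hS : S ⊆ Φ.good)
    (hS0 : liouville G N ε S = 0) : liouville G N ε (Φ.flow t '' S) = 0 := by
  rw [Φ.image_eq_preimage_of_subset_good t hS]
  exact measure_mono_null inter_subset_left (Φ.liouville_preimage_null (-t) hS0)

/-- The Liouville measure of a set is that of its good part. [folklore] -/
theorem _root_.Literature.Analysis.FluidPDE.HardSphereFlow.liouville_inter_good
    (Φ : HardSphereFlow G ε N) (A : Set (Config N d X)) :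
    liouville G N ε (A ∩ Φ.good) = liouville G N ε A :=
  measure_inter_conull Φ.measure_compl_good

/-- **The Liouville measure restricted to the good set is Lebesgue measure restricted to the good
set** (`good ⊆ D_ε^N`). [folklore] -/
theorem _root_.Literature.Analysis.FluidPDE.HardSphereFlow.liouville_restrict_good
    (Φ : HardSphereFlow G ε N) :
    (liouville G N ε).restrict Φ.good = volume.restrict Φ.good := by
  rw [liouville_eq, Measure.restrict_restrict Φ.measurableSet_good,
    inter_eq_left.2 Φ.good_subset]

/-- The Liouville measure *is* Lebesgue measure restricted to the good set (the good set being
conull in `D_ε^N`). [folklore] -/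
theorem _root_.Literature.Analysis.FluidPDE.HardSphereFlow.volume_restrict_good_eq
    (Φ : HardSphereFlow G ε N) : volume.restrict Φ.good = liouville G N ε := by
  rw [← Φ.liouville_restrict_good]
  exact Measure.restrict_eq_self_of_ae_mem Φ.ae_mem_good

/-- **Each `Φ_t` preserves Lebesgue measure restricted to the good set** (restatement of the
`measurePreserving` field through `volume_restrict_good_eq`; GST 2013 Prop. 4.1.1). [cite: GST2013, Prop. 4.1.1] -/
theorem _root_.Literature.Analysis.FluidPDE.HardSphereFlow.measurePreserving_restrict_good
    (Φ : HardSphereFlow G ε N) (t : ℝ) :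
    MeasurePreserving (Φ.flow t) (volume.restrict Φ.good) (volume.restrict Φ.good) := by
  rw [Φ.volume_restrict_good_eq]
  exact Φ.measurePreserving t

/-- Lebesgue-a.e. point of the good set (i.e. `volume.restrict good`-a.e. point) is good. [folklore] -/
theorem _root_.Literature.Analysis.FluidPDE.HardSphereFlow.ae_restrict_mem_good
    (Φ : HardSphereFlow G ε N) : ∀ᵐ z ∂(volume.restrict Φ.good), z ∈ Φ.good :=
  ae_restrict_mem Φ.measurableSet_good

/-- A subset of the good set is Liouville-null iff it is Lebesgue-null. [folklore] -/
theorem _root_.Literature.Analysis.FluidPDE.HardSphereFlow.liouville_eq_zero_iff_of_subset_good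
    (Φ : HardSphereFlow G ε N) {S : Set (Config N d X)} (hS : S ⊆ Φ.good) :
    liouville G N ε S = 0 ↔ volume S = 0 := by
  rw [← Φ.volume_restrict_good_eq]
  constructor
  · intro h
    have h' := h
    rw [Measure.restrict_apply' Φ.measurableSet_good, inter_eq_left.2 hS] at h'
    exact h'
  · intro h
    exact nonpos_iff_eq_zero.1 ((Measure.le_iff'.1 Measure.restrict_le_self S).trans h.le)

end Good

/-! ## §2. Right-continuity and joint measurability -/

section Measurable

variable {X : Type*} [MeasureSpace X] [TopologicalSpace X] {G : Geometry d X} {ε : ℝ} {N : ℕ}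

/-- **Orbits of good points are right-continuous** (positions are continuous, velocities jump
only at collision times, where the trajectory takes the post-collisional value; for a geometry
with continuous translations). [folklore] -/
theorem _root_.Literature.Analysis.FluidPDE.HardSphereFlow.tendsto_flow_nhdsGT
    (Φ : HardSphereFlow G ε N) (hG : ∀ x : X, Continuous (G.translate x)) {z : Config N d X}
    (hz : z ∈ Φ.good) (t : ℝ) :
    Tendsto (fun s => Φ.flow s z) (𝓝[>] t) (𝓝 (Φ.flow t z)) :=
  (Φ.isTrajectory z hz).tendsto_nhdsGT hG t

open scoped Classical in
/-- The flow with the junk value `z` off the good set, `good.piecewise (Φ_t) id`, agrees with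
the flow on the good set. Only a device to state joint measurability on `ℝ × good` as
measurability of a globally defined map. [folklore] -/
theorem piecewise_flow_of_mem (Φ : HardSphereFlow G ε N) (t : ℝ) {z : Config N d X}
    (hz : z ∈ Φ.good) : Φ.good.piecewise (Φ.flow t) id z = Φ.flow t z :=
  Set.piecewise_eq_of_mem _ _ _ hz

open scoped Classical in
/-- Off the good set the piecewise flow is the identity. [folklore] -/
theorem piecewise_flow_of_not_mem (Φ : HardSphereFlow G ε N) (t : ℝ) {z : Config N d X}
    (hz : z ∉ Φ.good) : Φ.good.piecewise (Φ.flow t) id z = z :=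
  Set.piecewise_eq_of_notMem _ _ _ hz

open scoped Classical in
/-- Each time-`t` map of the piecewise flow is measurable. [folklore] -/
theorem measurable_piecewise_flow_right (Φ : HardSphereFlow G ε N) (t : ℝ) :
    Measurable (Φ.good.piecewise (Φ.flow t) id) :=
  Measurable.piecewise Φ.measurableSet_good (Φ.measurable_flow t) measurable_id

/-- The upper dyadic approximation `d_n(t) = (⌊2^n t⌋ + 1) / 2^n` of a real number exceeds it:
`t < d_n(t)`. [folklore] -/
theorem lt_dyadUp (n : ℕ) (t : ℝ) : t < (((⌊t * 2 ^ n⌋ : ℤ) : ℝ) + 1) / 2 ^ n := by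
  have h2 : (0 : ℝ) < 2 ^ n := by positivity
  rw [lt_div_iff₀ h2]
  exact Int.lt_floor_add_one (t * 2 ^ n)

/-- `d_n(t) ≤ t + 2^{-n}`. [folklore] -/
theorem dyadUp_le (n : ℕ) (t : ℝ) : (((⌊t * 2 ^ n⌋ : ℤ) : ℝ) + 1) / 2 ^ n ≤ t + 1 / 2 ^ n := by
  have h2 : (0 : ℝ) < 2 ^ n := by positivity
  rw [div_le_iff₀ h2, add_mul, one_div, inv_mul_cancel₀ h2.ne']
  have := Int.floor_le (t * 2 ^ n)
  linarith

/-- The upper dyadic approximations converge from the right: `d_n(t) → t` within `(t, ∞)`. [folklore] -/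
theorem tendsto_dyadUp (t : ℝ) :
    Tendsto (fun n : ℕ => (((⌊t * 2 ^ n⌋ : ℤ) : ℝ) + 1) / 2 ^ n) atTop (𝓝[>] t) := by
  rw [tendsto_nhdsWithin_iff]
  refine ⟨?_, Eventually.of_forall fun n => lt_dyadUp n t⟩
  have h0 : Tendsto (fun n : ℕ => t + 1 / (2 : ℝ) ^ n) atTop (𝓝 t) := by
    have h := tendsto_pow_atTop_nhds_zero_of_lt_one (r := (2⁻¹ : ℝ)) (by norm_num) (by norm_num)
    have h' : Tendsto (fun n : ℕ => t + (2⁻¹ : ℝ) ^ n) atTop (𝓝 (t + 0)) := h.const_add t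
    rw [add_zero] at h'
    refine h'.congr fun n => ?_
    rw [one_div, inv_pow]
  exact tendsto_of_tendsto_of_tendsto_of_le_of_le tendsto_const_nhds h0
    (fun n => (lt_dyadUp n t).le) fun n => dyadUp_le n t

open scoped Classical in
/-- The dyadically discretised flow `(t, z) ↦ good.piecewise Φ_{d_n t} id z` is jointly
measurable: `d_n` takes countably many values, and on each level set it is a fixed measurable
time-map (`measurable_from_prod_countable_left`). [folklore] -/
theorem measurable_piecewise_flow_dyadUp (Φ : HardSphereFlow G ε N) (n : ℕ) :
    Measurable fun p : ℝ × Config N d X =>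
      Φ.good.piecewise (Φ.flow ((((⌊p.1 * 2 ^ n⌋ : ℤ) : ℝ) + 1) / 2 ^ n)) id p.2 := by
  -- factor through `(z, ⌊2^n t⌋) : Config × ℤ`
  let F : Config N d X × ℤ → Config N d X := fun q =>
    Φ.good.piecewise (Φ.flow (((q.2 : ℝ) + 1) / 2 ^ n)) id q.1
  have hF : Measurable F :=
    measurable_from_prod_countable_left fun k =>
      measurable_piecewise_flow_right Φ ((((k : ℤ) : ℝ) + 1) / 2 ^ n)
  have hπ : Measurable fun p : ℝ × Config N d X => (p.2, ⌊p.1 * 2 ^ n⌋) :=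
    measurable_snd.prodMk ((measurable_fst.mul_const _).floor)
  have : (fun p : ℝ × Config N d X =>
      Φ.good.piecewise (Φ.flow ((((⌊p.1 * 2 ^ n⌋ : ℤ) : ℝ) + 1) / 2 ^ n)) id p.2) =
        F ∘ fun p => (p.2, ⌊p.1 * 2 ^ n⌋) := by
    funext p
    rfl
  rw [this]
  exact hF.comp hπ

variable [BorelSpace X] [SecondCountableTopology X] [TopologicalSpace.PseudoMetrizableSpace X]

open scoped Classical in
/-- **Joint measurability of the hard-sphere flow on `ℝ × good`.** For a geometry with
continuous translations (e.g. `T^d`, `ℝ^d`) and a second-countable metrisable Borel position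
space, `(t, z) ↦ good.piecewise (Φ_t) id z` is measurable: it is the pointwise limit of the
measurable maps `(t, z) ↦ good.piecewise (Φ_{d_n t}) id z` (`measurable_piecewise_flow_dyadUp`),
by right-continuity of the orbits of good points (`HardSphereFlow.tendsto_flow_nhdsGT`) and
`d_n t ↓ t` (`tendsto_dyadUp`); the limit of measurable maps into a metrisable space is
measurable (`measurable_of_tendsto_metrizable`). The structure `HardSphereFlow` itself only
records the measurability of each `Φ_t` (Alexander 1975, Ch. 2). [cite: Alexander1975, Ch. 2] -/
theorem _root_.Literature.Analysis.FluidPDE.HardSphereFlow.measurable_piecewise_flow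
    (Φ : HardSphereFlow G ε N) (hG : ∀ x : X, Continuous (G.translate x)) :
    Measurable fun p : ℝ × Config N d X => Φ.good.piecewise (Φ.flow p.1) id p.2 := by
  have hf : ∀ n : ℕ, Measurable fun p : ℝ × Config N d X =>
      Φ.good.piecewise (Φ.flow ((((⌊p.1 * 2 ^ n⌋ : ℤ) : ℝ) + 1) / 2 ^ n)) id p.2 :=
    fun n => measurable_piecewise_flow_dyadUp Φ n
  have hlim : Tendsto (fun (n : ℕ) (p : ℝ × Config N d X) =>
      Φ.good.piecewise (Φ.flow ((((⌊p.1 * 2 ^ n⌋ : ℤ) : ℝ) + 1) / 2 ^ n)) id p.2) atTop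
      (𝓝 fun p => Φ.good.piecewise (Φ.flow p.1) id p.2) := by
    rw [tendsto_pi_nhds]
    rintro ⟨t, z⟩
    by_cases hz : z ∈ Φ.good
    · simp only [piecewise_flow_of_mem Φ _ hz]
      exact (Φ.tendsto_flow_nhdsGT hG hz t).comp (tendsto_dyadUp t)
    · simp only [piecewise_flow_of_not_mem Φ _ hz]
      exact tendsto_const_nhds
  exact measurable_of_tendsto_metrizable hf hlim

open scoped Classical in
/-- Joint measurability composed with measurable time and datum maps. [folklore] -/
theorem _root_.Literature.Analysis.FluidPDE.HardSphereFlow.measurable_piecewise_flow_comp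
    (Φ : HardSphereFlow G ε N) (hG : ∀ x : X, Continuous (G.translate x))
    {α : Type*} [MeasurableSpace α] {τ : α → ℝ} {ζ : α → Config N d X} (hτ : Measurable τ)
    (hζ : Measurable ζ) : Measurable fun a => Φ.good.piecewise (Φ.flow (τ a)) id (ζ a) :=
  (Φ.measurable_piecewise_flow hG).comp (hτ.prodMk hζ)

open scoped Classical in
/-- The set of `(t, z)` with `z` good and `Φ_t z ∈ S` is measurable for measurable `S`. [folklore] -/
theorem _root_.Literature.Analysis.FluidPDE.HardSphereFlow.measurableSet_flow_mem
    (Φ : HardSphereFlow G ε N) (hG : ∀ x : X, Continuous (G.translate x))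
    {S : Set (Config N d X)} (hS : MeasurableSet S) :
    MeasurableSet {p : ℝ × Config N d X | p.2 ∈ Φ.good ∧ Φ.flow p.1 p.2 ∈ S} := by
  have h1 : MeasurableSet {p : ℝ × Config N d X | p.2 ∈ Φ.good} :=
    measurable_snd Φ.measurableSet_good
  have h2 : MeasurableSet {p : ℝ × Config N d X | Φ.good.piecewise (Φ.flow p.1) id p.2 ∈ S} :=
    Φ.measurable_piecewise_flow hG hS
  have : {p : ℝ × Config N d X | p.2 ∈ Φ.good ∧ Φ.flow p.1 p.2 ∈ S} =
      {p : ℝ × Config N d X | p.2 ∈ Φ.good} ∩ {p | Φ.good.piecewise (Φ.flow p.1) id p.2 ∈ S} := by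
    ext ⟨t, z⟩
    simp only [mem_setOf_eq, mem_inter_iff]
    constructor
    · rintro ⟨hz, h⟩
      exact ⟨hz, by rwa [piecewise_flow_of_mem Φ _ hz]⟩
    · rintro ⟨hz, h⟩
      exact ⟨hz, by rwa [piecewise_flow_of_mem Φ _ hz] at h⟩
  rw [this]
  exact h1.inter h2

/-! ## §3. Almost every orbit spends a null set of times in a null set -/

variable [SigmaFinite (volume : Measure X)]

omit [TopologicalSpace X] [BorelSpace X] [SecondCountableTopology X]
  [TopologicalSpace.PseudoMetrizableSpace X] in
/-- The Liouville measure is σ-finite (a restriction of the σ-finite Lebesgue measure). [folklore] -/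
theorem sigmaFinite_liouville : SigmaFinite (liouville G N ε) := by
  rw [liouville_eq]
  infer_instance

open scoped Classical in
/-- **Almost every orbit spends a Lebesgue-null set of times in a Liouville-null set.** If
`S` is measurable with `liouville S = 0` then for Liouville-a.e. `z`,
`volume {t | Φ_t z ∈ S} = 0`. Proof: the set `A = {(t, z) | z good, Φ_t z ∈ S}` is measurable
(`measurableSet_flow_mem`); by Tonelli its `(volume ⊗ liouville)`-measure is
`∫ liouville (good ∩ Φ_t⁻¹ S) dt ≤ ∫ liouville (Φ_t⁻¹ S) dt = 0` (invariance of the Liouville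
measure at each fixed time), hence almost every `z`-section of `A` is null. [folklore] -/
theorem _root_.Literature.Analysis.FluidPDE.HardSphereFlow.ae_volume_setOf_flow_mem_eq_zero
    (Φ : HardSphereFlow G ε N) (hG : ∀ x : X, Continuous (G.translate x))
    {S : Set (Config N d X)} (hS : MeasurableSet S) (hS0 : liouville G N ε S = 0) :
    ∀ᵐ z ∂(liouville G N ε), volume {t : ℝ | Φ.flow t z ∈ S} = 0 := by
  haveI := sigmaFinite_liouville (G := G) (N := N) (ε := ε)
  set A : Set (Config N d X × ℝ) := {p | p.1 ∈ Φ.good ∧ Φ.flow p.2 p.1 ∈ S} with hA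
  have hAm : MeasurableSet A := by
    have h := Φ.measurableSet_flow_mem hG hS
    have : A = Prod.swap ⁻¹' {p : ℝ × Config N d X | p.2 ∈ Φ.good ∧ Φ.flow p.1 p.2 ∈ S} := by
      ext ⟨z, t⟩
      simp [hA]
    rw [this]
    exact measurable_swap h
  -- the measure of `A` vanishes, computing the `t`-sections
  have hsec0 : ∀ t : ℝ, liouville G N ε (Prod.mk t ⁻¹' (Prod.swap ⁻¹' A)) = 0 := by
    intro t
    have hsub : Prod.mk t ⁻¹' (Prod.swap ⁻¹' A) ⊆ Φ.flow t ⁻¹' S := by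
      intro z hz
      simp only [hA, mem_preimage, Prod.swap_prod_mk, mem_setOf_eq] at hz
      exact hz.2
    exact measure_mono_null hsub (Φ.liouville_preimage_null t hS0)
  have hA0 : ((liouville G N ε).prod (volume : Measure ℝ)) A = 0 := by
    rw [← Measure.prod_swap, Measure.map_apply measurable_swap hAm, Measure.prod_apply
      (measurable_swap hAm)]
    simp only [hsec0, lintegral_zero]
  -- hence almost every `z`-section is null
  have hsec : (fun z => (volume : Measure ℝ) (Prod.mk z ⁻¹' A)) =ᵐ[liouville G N ε] 0 :=
    (Measure.measure_prod_null hAm).1 hA0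
  filter_upwards [hsec, Φ.ae_mem_good] with z hz hzg
  have : {t : ℝ | Φ.flow t z ∈ S} = Prod.mk z ⁻¹' A := by
    ext t
    simp [hA, hzg]
  rw [this]
  exact hz

/-- The same, as an almost-everywhere statement in time: for Liouville-a.e. `z`, for a.e. `t`,
`Φ_t z ∉ S`. [folklore] -/
theorem _root_.Literature.Analysis.FluidPDE.HardSphereFlow.ae_ae_flow_not_mem
    (Φ : HardSphereFlow G ε N) (hG : ∀ x : X, Continuous (G.translate x))
    {S : Set (Config N d X)} (hS : MeasurableSet S) (hS0 : liouville G N ε S = 0) :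
    ∀ᵐ z ∂(liouville G N ε), ∀ᵐ t : ℝ, Φ.flow t z ∉ S := by
  filter_upwards [Φ.ae_volume_setOf_flow_mem_eq_zero hG hS hS0] with z hz
  rw [ae_iff]
  simpa using hz

end Measurable

/-! ## §4. The torus case -/

section Torus

variable {ε : ℝ} {N : ℕ}

open scoped Classical in
/-- Joint measurability of a hard-sphere flow on the torus on `ℝ × good`. [folklore] -/
theorem measurable_piecewise_flow_torus (Φ : HardSphereFlow (Torus.geometry d) ε N) :
    Measurable fun p : ℝ × Config N d (UnitAddTorus d) => Φ.good.piecewise (Φ.flow p.1) id p.2 :=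
  Φ.measurable_piecewise_flow Torus.continuous_geometry_translate

/-- On the torus: for Liouville-a.e. datum, a.e. in time the orbit avoids a given null set. [folklore] -/
theorem ae_ae_flow_not_mem_torus (Φ : HardSphereFlow (Torus.geometry d) ε N)
    {S : Set (Config N d (UnitAddTorus d))} (hS : MeasurableSet S)
    (hS0 : liouville (Torus.geometry d) N ε S = 0) :
    ∀ᵐ z ∂(liouville (Torus.geometry d) N ε), ∀ᵐ t : ℝ, Φ.flow t z ∉ S :=
  Φ.ae_ae_flow_not_mem Torus.continuous_geometry_translate hS hS0

end Torus

end

end Literature.MathematicalPhysics.KineticTheory
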